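import Summits.BirchSwinnertonDyer.Rank1Residual.X1.CyclotomicZeros
import Literature.NumberTheory.EllipticCurves.KatoRankBoundProofs
import Mathlib.RingTheory.Polynomial.Eisenstein.Basic
import Summits.BirchSwinnertonDyer.Rank1Residual.Iwasawa.RankConversion
import HarnessLib

/-!
# `ξ_p = Φ_p(1+T)` is a height-one prime of `Λ`, and `ξ_p^t ∣ char_Λ X` from `ℤ_p`-independent
# elements of `X/ξ_p X` (cell `b2b-bsdres`; prover unit `b2b-bsdres-additive-p3`, gen 15)

HONEST FRAMING (run/shared/lean/b2b/bsd-rank1-residual/, verbatim in every file): the goal of the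
cell is to DELETE the COMBINATION-SHAPED residual classes of the Birch–Swinnerton-Dyer formula for
ALL analytic-rank `≤ 1` elliptic curves over `ℚ` — "full BSD formula for every rank `≤ 1` curve in
class `C`" assembled STRICTLY from published theorems — so that the rank-`≤ 1` remainder becomes
exactly the CONSTRUCTION-SHAPED classes, which are TYPED (missing-input `Prop`s), NOT attempted.
This is not "finishing BSD". THEOREMS ONLY (commutative algebra of `Λ = ℤ_p⟦T⟧`); no named fact;
nothing about any curve; nothing booked; no label changes.

This is the algebra half of the Γ-EQUIVARIANT refinement of Greenberg's rank bound (LNM 1716,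
§5 p. 132, the `34A1` argument "`θ_1^t` divides `f_E(T)`"; the arithmetic half is
`Iwasawa/RankGrowthCyclotomicFactor.lean`). For the polynomial `ξ_p = Φ_p(1+T) ∈ Λ` of
eisenstein-p1's route C (`X1.CyclotomicZeros.xi`):

* §1 `ξ_p` is PRIME in `Λ` of height one (`isPrime_span_xi`, `height_span_xi`): Eisenstein at `p`
  (`xiPoly_irreducible`, Mathlib `cyclotomic_comp_X_add_one_isEisensteinAt` via the tree's
  `xiPoly_isDistinguishedAt`), `ℤ_p[X]` is a UFD, and `Λ/(ξ_p) ≅ ℤ_p[X]/(ξ_p)` by Weierstrass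
  division (Mathlib `Polynomial.IsDistinguishedAt.algEquivQuotient`).
* §2 for a finitely generated torsion `Λ`-module `X`: `g ∈ char_Λ X ⇒ ξ_p^ℓ ∣ g`,
  `ℓ = length_{Λ_(ξ)} X_(ξ)` (`xi_pow_dvd_of_mem_charIdeal_of_le_lengthAt`), and
  `t ≤ ℓ` as soon as `X/ξ_p X` has `t` elements independent over `𝒪 = Λ/(ξ_p)`
  (`natCast_le_lengthAt_of_linearIndependent`; the pattern of the tree's `(T)`-adic
  `natCast_le_length_localizedModule_coinvariants`, Washington §13.2 / Bourbaki AC VII §4.4).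
* rank conversion `ℤ_p ↝ 𝒪` is the sibling file `Iwasawa/RankConversion.lean`
  (`exists_linearIndependent_of_rank_le`: `d·t` `ℤ_p`-independent elements of an `𝒪`-module give
  `t` `𝒪`-independent ones, `d = p − 1 = rank_{ℤ_p} 𝒪`; `𝒪` is a domain by §1, free of rank
  `p − 1` by Weierstrass division, `free_finite_finrank_quotient_xi`).
* §3 CONCLUSION `xi_pow_dvd_of_mem_charIdeal_of_indep`: if `x_1, …, x_n ∈ X` satisfy
  "`∑ c_k x_k ∈ ξ_p X` (`c_k ∈ ℤ_p`) only for `c = 0`" and `(p − 1)·t ≤ n`, then `ξ_p^t ∣ g` for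
  every `g ∈ char_Λ X`.

References: L. C. Washington, *Introduction to Cyclotomic Fields*, §13.2 (structure theory of
`Λ`-modules; Prop. 13.8); N. Bourbaki, *Algèbre commutative* VII §4.4 (lengths at height-one
primes); R. Greenberg, LNM 1716 (1999), §5 p. 132.
-/

noncomputable section

open scoped Polynomial

namespace Summit.BirchSwinnertonDyer.Rank1Residual.Iwasawa

open Literature.NumberTheory.EllipticCurves
open Summit.BirchSwinnertonDyer.Rank1Residual.X1.CyclotomicZeros

universe u

variable (p : ℕ) [Fact p.Prime]

/-! ## §1 `ξ_p` is a height-one prime of `Λ` -/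

/-- `ξ_p(X) = Φ_p(X+1) ∈ ℤ_p[X]` is Eisenstein at `p` (its lower coefficients lie in `(p)`,
`xiPoly_isDistinguishedAt`, and `ξ_p(0) = p ∉ (p²)`). [folklore] -/
theorem xiPoly_isEisensteinAt :
    (xiPoly p).IsEisensteinAt (IsLocalRing.maximalIdeal ℤ_[p]) := by
  refine (xiPoly_monic p).isEisensteinAt_of_mem_of_notMem
    (Ideal.IsPrime.ne_top inferInstance) (fun hn ↦ (xiPoly_isDistinguishedAt p).mem hn) ?_
  have h0 : (xiPoly p).coeff 0 = (p : ℤ_[p]) := by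
    rw [← Polynomial.coeff_coe, PowerSeries.coeff_zero_eq_constantCoeff]
    exact constantCoeff_xi p
  rw [h0, PadicInt.maximalIdeal_eq_span_p, Ideal.span_singleton_pow, Ideal.mem_span_singleton]
  intro hdvd
  have hp0 : (p : ℤ_[p]) ≠ 0 := by exact_mod_cast (Fact.out : p.Prime).ne_zero
  have h1 : (p : ℤ_[p]) ∣ 1 := by
    obtain ⟨c, hc⟩ := hdvd
    exact ⟨c, mul_left_cancel₀ hp0 (by rw [mul_one]; rw [sq, mul_assoc] at hc; exact hc)⟩
  exact PadicInt.irreducible_p.not_isUnit (isUnit_of_dvd_one h1)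

/-- `ξ_p(X)` is irreducible in `ℤ_p[X]` (Eisenstein's criterion). [folklore] -/
theorem xiPoly_irreducible : Irreducible (xiPoly p) := by
  refine (xiPoly_isEisensteinAt p).irreducible inferInstance (xiPoly_monic p).isPrimitive ?_
  rw [natDegree_xiPoly]
  have := (Fact.out : p.Prime).two_le
  omega

/-- `ξ_p(X)` is prime in the UFD `ℤ_p[X]`. [folklore] -/
theorem xiPoly_prime : Prime (xiPoly p) :=
  (xiPoly_irreducible p).prime

/-- **`(ξ_p) ⊂ Λ` is a prime ideal**: `Λ/(ξ_p) ≅ ℤ_p[X]/(ξ_p)` (Weierstrass division for the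
distinguished polynomial `ξ_p`, Mathlib `Polynomial.IsDistinguishedAt.algEquivQuotient`) is a
domain. Washington, *Cyclotomic Fields*, Prop. 13.8 / §13.2. [folklore] -/
theorem isPrime_span_xi : (Ideal.span {xi p}).IsPrime := by
  have h1 : (Ideal.span {xiPoly p}).IsPrime :=
    (Ideal.span_singleton_prime (xiPoly_monic p).ne_zero).mpr (xiPoly_prime p)
  haveI : IsDomain (ℤ_[p][X] ⧸ Ideal.span {xiPoly p}) :=
    (Ideal.Quotient.isDomain_iff_prime _).mpr h1
  haveI : IsDomain (IwasawaAlgebra p ⧸ Ideal.span {xi p}) :=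
    (xiPoly_isDistinguishedAt p).algEquivQuotient.symm.toMulEquiv.isDomain _
  exact (Ideal.Quotient.isDomain_iff_prime _).mp this

/-- `ξ_p` is not a unit of `Λ` (its constant term `p` is not a unit of `ℤ_p`). [folklore] -/
theorem not_isUnit_xi : ¬ IsUnit (xi p) := by
  rw [PowerSeries.isUnit_iff_constantCoeff, constantCoeff_xi]
  exact PadicInt.irreducible_p.not_isUnit

/-- `(ξ_p) ⊂ Λ` has height one (nonzero principal prime; Krull). [folklore] -/
theorem height_span_xi : (Ideal.span {xi p}).height = 1 :=
  Ideal.height_span_singleton_eq_one_of_mem_nonZeroDivisors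
    (mem_nonZeroDivisors_of_ne_zero (xi_ne_zero p)) (not_isUnit_xi p)

/-! ## §2 `ξ_p^t ∣ g` for `g ∈ char_Λ X` from the local length at `(ξ_p)` -/

section Length

variable {p}
variable (𝔭 : PrimeSpectrum (IwasawaAlgebra p)) (h𝔭 : 𝔭.asIdeal = Ideal.span {xi p})

include h𝔭 in
/-- **`g ∈ char_Λ X ⇒ ξ_p^t ∣ g` whenever `t ≤ length_{Λ_(ξ)} X_(ξ)`** (`X` finitely generated and
torsion): `char_Λ X = ∏_{ht 𝔮 = 1} 𝔮^{ℓ_𝔮}` is a genuine finite product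
(`Module.finite_heightOne_inter_mulSupport`) containing the factor `(ξ_p)^{ℓ}` with
`ℓ = ℓ_{(ξ_p)}(X) < ∞` (`Module.lengthAt_ne_top_of_isTorsionBy`, `(ξ_p)` has height one). The
`(T)`-adic twin is the tree's `lengthAt_primeT_le_order`. Washington §13.2; Bourbaki AC VII §4.5.
[folklore] -/
theorem xi_pow_dvd_of_mem_charIdeal_of_le_lengthAt (X : Type u) [AddCommGroup X]
    [Module (IwasawaAlgebra p) X] [Module.Finite (IwasawaAlgebra p) X]
    (hX : Module.IsTorsion (IwasawaAlgebra p) X) {g : IwasawaAlgebra p}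
    (hg : g ∈ Module.charIdeal (IwasawaAlgebra p) X) {t : ℕ}
    (ht : (t : ℕ∞) ≤ Module.lengthAt (IwasawaAlgebra p) X 𝔭) : xi p ^ t ∣ g := by
  obtain ⟨s, hs, hs0⟩ := Submodule.annihilator_top_inter_nonZeroDivisors hX
  have hsX : ∀ m : X, s • m = 0 := fun m ↦ Submodule.mem_annihilator.mp hs m Submodule.mem_top
  have hht : 𝔭.asIdeal.height = 1 := by rw [h𝔭]; exact height_span_xi p
  have hne : Module.lengthAt (IwasawaAlgebra p) X 𝔭 ≠ ⊤ :=
    Module.lengthAt_ne_top_of_isTorsionBy (nonZeroDivisors.ne_zero hs0) (fun m ↦ hsX m) _ hht.le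
  rw [← ENat.coe_toNat hne] at ht
  set l := (Module.lengthAt (IwasawaAlgebra p) X 𝔭).toNat with hl
  have hfin : (Function.mulSupport fun 𝔮 : PrimeSpectrum (IwasawaAlgebra p) ↦
      ({𝔮 | 𝔮.asIdeal.height = 1} : Set (PrimeSpectrum (IwasawaAlgebra p))).mulIndicator
        (fun 𝔮 ↦ 𝔮.asIdeal ^ (Module.lengthAt (IwasawaAlgebra p) X 𝔮).toNat) 𝔮).Finite := by
    rw [Set.mulSupport_mulIndicator]
    exact Module.finite_heightOne_inter_mulSupport (nonZeroDivisors.ne_zero hs0) fun m ↦ hsX m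
  have hle : Module.charIdeal (IwasawaAlgebra p) X ≤ 𝔭.asIdeal ^ l := by
    apply Ideal.le_of_dvd
    unfold Module.charIdeal
    rw [finprod_mem_def]
    have h := finprod_mem_dvd 𝔭 hfin
    rwa [Set.mulIndicator_of_mem (show 𝔭 ∈
      ({𝔮 | 𝔮.asIdeal.height = 1} : Set (PrimeSpectrum (IwasawaAlgebra p))) from hht)] at h
  have hmem : g ∈ Ideal.span {xi p ^ l} := by
    rw [← Ideal.span_singleton_pow, ← h𝔭]
    exact hle hg
  exact (pow_dvd_pow _ (by exact_mod_cast ht)).trans (Ideal.mem_span_singleton.mp hmem)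

include h𝔭 in
/-- `(Λ/(ξ_p))_{(ξ_p)} ≠ 0` (it is the residue field of `Λ_{(ξ_p)}`): `(ξ_p) ⊇ Ann_Λ Λ/(ξ_p)`.
[folklore] -/
theorem nontrivial_localizedModule_quotient_xi :
    Nontrivial (LocalizedModule 𝔭.asIdeal.primeCompl
      (IwasawaAlgebra p ⧸ Ideal.span {xi p})) :=
  Module.mem_support_iff.mp
    (Module.mem_support_iff_of_finite.mpr (by rw [Ideal.annihilator_quotient, h𝔭]))

/-- Localisation at `𝔭` is exact: `length M_𝔭 ≤ length N_𝔭` for `M ↪ N`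
(Bourbaki AC II §2.4; `Module.length_le_of_injective`). [folklore] -/
theorem length_localizedModule_le_of_injective {M N : Type*} [AddCommGroup M]
    [Module (IwasawaAlgebra p) M] [AddCommGroup N] [Module (IwasawaAlgebra p) N]
    (Φ : M →ₗ[IwasawaAlgebra p] N) (hΦ : Function.Injective Φ) :
    Module.length (Localization.AtPrime 𝔭.asIdeal)
        (LocalizedModule 𝔭.asIdeal.primeCompl M) ≤
      Module.length (Localization.AtPrime 𝔭.asIdeal)
        (LocalizedModule 𝔭.asIdeal.primeCompl N) :=
  Module.length_le_of_injective
    (LocalizedModule.map 𝔭.asIdeal.primeCompl Φ) (LocalizedModule.map_injective _ Φ hΦ)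

/-- Localisation at `𝔭` is exact: `length N_𝔭 ≤ length M_𝔭` for `M ↠ N`
(Bourbaki AC II §2.4; `Module.length_le_of_surjective`). [folklore] -/
theorem length_localizedModule_le_of_surjective {M N : Type*} [AddCommGroup M]
    [Module (IwasawaAlgebra p) M] [AddCommGroup N] [Module (IwasawaAlgebra p) N]
    (Φ : M →ₗ[IwasawaAlgebra p] N) (hΦ : Function.Surjective Φ) :
    Module.length (Localization.AtPrime 𝔭.asIdeal)
        (LocalizedModule 𝔭.asIdeal.primeCompl N) ≤
      Module.length (Localization.AtPrime 𝔭.asIdeal)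
        (LocalizedModule 𝔭.asIdeal.primeCompl M) :=
  Module.length_le_of_surjective
    (LocalizedModule.map 𝔭.asIdeal.primeCompl Φ) (LocalizedModule.map_surjective _ Φ hΦ)

include h𝔭 in
/-- **`t ≤ length_{Λ_(ξ)} X_(ξ)` if `X/ξ_p X` has `t` elements independent over `𝒪 = Λ/(ξ_p)`.**
They span an injective `Λ`-linear map `𝒪^{⊕ t} → X/ξ_p X`; localisation at `𝔭 = (ξ_p)` is exact,
`(𝒪^{⊕ t})_𝔭 ≅ (𝒪_𝔭)^{⊕ t}` has length `t · length 𝒪_𝔭 ≥ t`, and `X ↠ X/ξ_p X`. The `(T)`-adic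
twin is the tree's `natCast_le_length_localizedModule_coinvariants`. Bourbaki AC VII §4.4;
Washington §13.2. [folklore] -/
theorem natCast_le_lengthAt_of_linearIndependent (X : Type u) [AddCommGroup X]
    [Module (IwasawaAlgebra p) X] {t : ℕ}
    {y : Fin t → X ⧸ (Ideal.span {xi p} • ⊤ : Submodule (IwasawaAlgebra p) X)}
    (hy : LinearIndependent (IwasawaAlgebra p ⧸ Ideal.span {xi p}) y) :
    (t : ℕ∞) ≤ Module.lengthAt (IwasawaAlgebra p) X 𝔭 := by
  -- the injective `Λ`-linear map `Φ : 𝒪^{⊕ t} → Y = X/ξX`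
  have hΦ : Function.Injective ((Finsupp.linearCombination
      (IwasawaAlgebra p ⧸ Ideal.span {xi p}) y).restrictScalars (IwasawaAlgebra p)) := by
    rw [LinearMap.coe_restrictScalars]
    exact hy
  have hFY := length_localizedModule_le_of_injective 𝔭 _ hΦ
  have hF : Module.length (Localization.AtPrime 𝔭.asIdeal)
      (LocalizedModule 𝔭.asIdeal.primeCompl (Fin t →₀
        (IwasawaAlgebra p ⧸ Ideal.span {xi p}))) =
      Module.length (Localization.AtPrime 𝔭.asIdeal)
        (Fin t →₀ LocalizedModule 𝔭.asIdeal.primeCompl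
          (IwasawaAlgebra p ⧸ Ideal.span {xi p})) :=
    LinearEquiv.length_eq
      ((IsLocalizedModule.iso 𝔭.asIdeal.primeCompl
        (Finsupp.mapRange.linearMap (α := Fin t)
          (LocalizedModule.mkLinearMap 𝔭.asIdeal.primeCompl
            (IwasawaAlgebra p ⧸ Ideal.span {xi p})))
        ).extendScalarsOfIsLocalization 𝔭.asIdeal.primeCompl
          (Localization.AtPrime 𝔭.asIdeal))
  have hC : Module.length (Localization.AtPrime 𝔭.asIdeal)
      (Fin t →₀ LocalizedModule 𝔭.asIdeal.primeCompl
        (IwasawaAlgebra p ⧸ Ideal.span {xi p})) =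
      t * Module.length (Localization.AtPrime 𝔭.asIdeal)
        (LocalizedModule 𝔭.asIdeal.primeCompl
          (IwasawaAlgebra p ⧸ Ideal.span {xi p})) := by
    rw [Module.length_finsupp, ENat.card_eq_coe_fintype_card, Fintype.card_fin]
  rw [hF, hC] at hFY
  have hk : (1 : ℕ∞) ≤ Module.length (Localization.AtPrime 𝔭.asIdeal)
      (LocalizedModule 𝔭.asIdeal.primeCompl
        (IwasawaAlgebra p ⧸ Ideal.span {xi p})) := by
    haveI := nontrivial_localizedModule_quotient_xi 𝔭 h𝔭
    exact Order.one_le_iff_pos.mpr Module.length_pos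
  have hY : Module.length (Localization.AtPrime 𝔭.asIdeal)
      (LocalizedModule 𝔭.asIdeal.primeCompl
        (X ⧸ (Ideal.span {xi p} • ⊤ : Submodule (IwasawaAlgebra p) X))) ≤
      Module.lengthAt (IwasawaAlgebra p) X 𝔭 :=
    length_localizedModule_le_of_surjective 𝔭
      (Submodule.mkQ (Ideal.span {xi p} • ⊤ : Submodule (IwasawaAlgebra p) X))
      (Submodule.mkQ_surjective _)
  calc (t : ℕ∞) = t * 1 := (mul_one _).symm
    _ ≤ t * Module.length (Localization.AtPrime 𝔭.asIdeal)
        (LocalizedModule 𝔭.asIdeal.primeCompl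
          (IwasawaAlgebra p ⧸ Ideal.span {xi p})) := by gcongr
    _ ≤ _ := hFY
    _ ≤ _ := hY

end Length

/-! ## §3 `ξ_p^t ∣ char_Λ X` from `(p−1)·t` elements of `X` independent modulo `ξ_p X` -/

section Assembly

variable {p}

/-- `𝒪 = Λ/(ξ_p)` is a free `ℤ_p`-module of rank `p − 1` and finite (Weierstrass division, the
tree's `free_quotient_pow` / `finrank_quotient_pow` at exponent `1`). [folklore] -/
theorem free_finite_finrank_quotient_xi :
    Module.Free ℤ_[p] (IwasawaAlgebra p ⧸ Ideal.span {xi p}) ∧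
      Module.Finite ℤ_[p] (IwasawaAlgebra p ⧸ Ideal.span {xi p}) ∧
      Module.finrank ℤ_[p] (IwasawaAlgebra p ⧸ Ideal.span {xi p}) = p - 1 := by
  have e : Ideal.span {xi p} = Ideal.span {((xiPoly p : ℤ_[p][X]) : IwasawaAlgebra p) ^ 1} := by
    rw [pow_one]; rfl
  rw [e]
  exact ⟨free_quotient_pow p (xiPoly_isDistinguishedAt p) 1,
    finite_quotient_pow p (xiPoly_isDistinguishedAt p) 1,
    by rw [finrank_quotient_pow p (xiPoly_isDistinguishedAt p) 1, one_mul,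
      natDegree_xiPoly]⟩

/-- **`ξ_p^t ∣ g` for `g ∈ char_Λ X`, from `(p − 1)·t` elements of `X` that are `ℤ_p`-independent
modulo `ξ_p X`.** For a finitely generated torsion `Λ`-module `X` and `x_1, …, x_n ∈ X` such that
`∑ c_k x_k ∈ ξ_p X` with `c_k ∈ ℤ_p` forces `c = 0`: if `(p − 1)·t ≤ n` then `ξ_p^t` divides every
element of the characteristic ideal of `X`. (Rank conversion, `Iwasawa/RankConversion.lean`, turns
the `x_k` into `t` elements of `X/ξ_p X` independent over the domain `Λ/(ξ_p)`; §2 turns those into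
`t ≤ length_{Λ_(ξ)} X_(ξ)` and the divisibility.) In structure-theorem terms (`X ∼ ⊕ Λ/(p^{μ_i}) ⊕ ⊕ Λ/(f_j^{a_j})`, Washington
Thm. 13.12): `rank_{ℤ_p} X/ξ_p X = (p−1)·#{j : f_j = ξ_p}` and `ξ_p^{#{j : f_j = ξ_p}} ∣ ∏ f_j^{a_j}`.
[folklore] -/
theorem xi_pow_dvd_of_mem_charIdeal_of_indep (X : Type u) [AddCommGroup X]
    [Module (IwasawaAlgebra p) X] [Module.Finite (IwasawaAlgebra p) X]
    (hX : Module.IsTorsion (IwasawaAlgebra p) X) {n : ℕ} (x : Fin n → X)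
    (hx : ∀ (c : Fin n → ℤ_[p]) (y : X),
      ∑ k, (PowerSeries.C (c k) : IwasawaAlgebra p) • x k = xi p • y → ∀ k, c k = 0)
    {t : ℕ} (ht : (p - 1) * t ≤ n) {g : IwasawaAlgebra p}
    (hg : g ∈ Module.charIdeal (IwasawaAlgebra p) X) : xi p ^ t ∣ g := by
  classical
  -- the prime `𝔭 = (ξ_p)` and the quotient `Y = X / ξ_p X` as a module over `𝒪 = Λ/(ξ_p)`
  let 𝔭 : PrimeSpectrum (IwasawaAlgebra p) := ⟨Ideal.span {xi p}, isPrime_span_xi p⟩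
  let Y := X ⧸ (Ideal.span {xi p} • ⊤ : Submodule (IwasawaAlgebra p) X)
  letI : Module ℤ_[p] Y := Module.compHom Y (algebraMap ℤ_[p] (IwasawaAlgebra p))
  haveI : IsScalarTower ℤ_[p] (IwasawaAlgebra p) Y := IsScalarTower.of_compHom ℤ_[p] _ _
  haveI : IsScalarTower ℤ_[p] (IwasawaAlgebra p ⧸ Ideal.span {xi p}) Y := inferInstance
  -- the images of the `x_k` are `ℤ_p`-independent in `Y`
  have hli : LinearIndependent ℤ_[p]
      (fun k ↦ (Submodule.Quotient.mk (x k) : Y)) := by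
    rw [Fintype.linearIndependent_iff]
    intro c hc
    have hsum : (Submodule.Quotient.mk (∑ k, (PowerSeries.C (c k) : IwasawaAlgebra p) • x k) : Y)
        = 0 := by
      rw [← hc, ← Submodule.mkQ_apply, map_sum]
      refine Finset.sum_congr rfl fun k _ ↦ ?_
      rw [map_smul, Submodule.mkQ_apply]
      change _ = (algebraMap ℤ_[p] (IwasawaAlgebra p) (c k)) • (Submodule.Quotient.mk (x k) : Y)
      rw [PowerSeries.algebraMap_eq]
    rw [Submodule.Quotient.mk_eq_zero, Submodule.ideal_span_singleton_smul,
      Submodule.mem_smul_pointwise_iff_exists] at hsum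
    obtain ⟨y, -, hy⟩ := hsum
    exact hx c y hy.symm
  have hrank : (((p - 1) * t : ℕ) : Cardinal) ≤ Module.rank ℤ_[p] Y :=
    le_trans (by exact_mod_cast ht) (natCast_le_rank_iff.mpr ⟨_, hli⟩)
  -- rank conversion to `𝒪 = Λ/(ξ_p)`
  obtain ⟨hfree, hfin, hrk⟩ := free_finite_finrank_quotient_xi (p := p)
  haveI := hfree; haveI := hfin
  haveI : IsDomain (IwasawaAlgebra p ⧸ Ideal.span {xi p}) :=
    (Ideal.Quotient.isDomain_iff_prime _).mpr (isPrime_span_xi p)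
  have hd : Module.rank ℤ_[p] (IwasawaAlgebra p ⧸ Ideal.span {xi p}) ≤ (p - 1 : ℕ) := by
    rw [← Module.finrank_eq_rank, hrk]
  have hp1 : 1 ≤ p - 1 := by have := (Fact.out : p.Prime).two_le; omega
  obtain ⟨z, hz⟩ := exists_linearIndependent_of_rank_le hp1 hd
    (fun α hα ↦ exists_dvd_algebraMap_of_ne_zero α hα) t Y hrank
  -- lengths
  exact xi_pow_dvd_of_mem_charIdeal_of_le_lengthAt 𝔭 rfl X hX hg
    (natCast_le_lengthAt_of_linearIndependent 𝔭 rfl X hz)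

end Assembly

end Summit.BirchSwinnertonDyer.Rank1Residual.Iwasawa
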